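import Literature.AlgebraicGeometry.HodgeTheory.WeilTypeRationalDatum
import Literature.AlgebraicGeometry.HodgeTheory.WeilTypeAbelianVariety
import Literature.AlgebraicGeometry.Motives.WeilDatumHodgeStructure
import Literature.AlgebraicGeometry.Motives.WeilTypeComplexStructures
import Literature.AlgebraicGeometry.HodgeTheory.WeilFamilyReachSimilarOfSystem
import Literature.AlgebraicGeometry.HodgeTheory.WeilClassesBlochSeed
import Literature.AlgebraicGeometry.Motives.AbelianVarietyProduct
import HarnessLib

/-!
# Route EightfoldBlochSeeds — objects the route posits (definitions): Riemann realisability at Weil type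

§1 `RealisedBy`, `RiemannRealisableAt n d` — VERBATIM the two definitions of the registered crux skeleton
`Cruxes/ReachHyperbolic/Lines/moduli_riemann.lean` (1ba65e5152037605, crux `ReachHyperbolic`, item stmt-HodgeConjecture-18883, line
`moduli-riemann`), in whose vocabulary the registered stubs `stub_riemannRealisable : ∀ n d, 1 ≤ n → 1 ≤ d → RiemannRealisableAt n d`
and `stub_rung_riemannSurfaces : ∀ d, 1 ≤ d → RiemannRealisableAt 1 d` are stated. Crux workfiles are not importable from `Theorems/`,
so the stubs can only be closed BY NAME from a Theorems file if their vocabulary exists here (D-0016/17: route-posited objects live in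
`Theorems/<RouteSlug>Defs.lean`). Bodies unchanged (copy-paste; `Iff.rfl` with the skeleton's when both are in scope).

* `RealisedBy n d P ψ₀ e ha ha0 hm hPm hd' hψ hω hω0 J hW B Φ β` — RIEMANN REALISABILITY of one Weil complex structure `J` on the rational
  Weil datum `weilDatumOfKsymm …` of `(P, ψ₀, h_K, ω)` by `(B, Φ, β)`: `dim B = 2n`, `Φ ≫ Φ = -d`, the `ℚ`-isomorphism
  `β : H¹(P(ℂ); ℚ) ≃ H¹(B(ℂ); ℚ)` intertwines `ψ₀^*` with `Φ^*` and carries the `(1,0)`-piece of `J`'s Hodge structure into `H^{1,0}(B)`.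
* `RiemannRealisableAt n d` — RIEMANN'S EXISTENCE THEOREM AT WEIL TYPE `(n, n)`, discriminant `d`: every such `J` is realised.

Status: `RiemannRealisableAt n d` HOLDS for all `n, d` — `Theorems.exists_realisedBy_of_isWeilComplexStructure`
(`Theorems/EightfoldBlochSeedsReachHyperbolicRiemannRealisable.lean`: Riemann's essential image + fullness + faithfulness, Deligne–Milne
Thm. 6.20, and Shimura's principal model, all tree theorems); the by-name stub file follows this one.

[cite: MumfordAV1970, §1–§3] [cite: BirkenhakeLange2004, Thm. 4.2.1] [cite: DeligneMilne1982Tannakian, art. II §6 Thm. 6.20]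
[cite: Deligne1982HodgeCycles, §4 Prop. 4.4, Lemma 4.6 and proof of Thm. 4.8 (p. 47)]
-/

noncomputable section

-- single-problem summit (Problem = Summit): the mandated namespace repeats `HodgeConjecture`.
set_option linter.dupNamespace false

open CategoryTheory AlgebraicGeometry
open scoped TensorProduct
open Literature.AlgebraicGeometry Literature.AlgebraicGeometry.Motives Literature.AlgebraicGeometry.HodgeTheory
open Literature.AlgebraicTopology.SingularHomology

namespace Summit.HodgeConjecture.HodgeConjecture.Theorems.EightfoldBlochSeeds

/-- RIEMANN REALISABILITY of one Weil complex structure `J` on the datum of `(P, ψ₀, h_K, ω)`: `(H¹(P, ℚ), J)` is the `H¹` of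
an abelian variety `B` of dimension `2n` with `Φ² = -d`, marked by `β` intertwining `ψ₀` and `Φ` and carrying the
`(1,0)`-piece of `J` into `H^{1,0}(B)` (verbatim the skeleton's `Cruxes.ReachHyperbolic.ModuliRiemann.RealisedBy`).
[cite: MumfordAV1970, §1–§3] [cite: BirkenhakeLange2004, Thm. 4.2.1] -/
def RealisedBy (n d : ℕ) (P : AbelianVariety ℂ) (ψ₀ : P ⟶ P) (e : ProjectiveEmbedding P.X)
    {a : complexBetti (projectiveSpace e.n ℂ) 2} (ha : IsRationalClass a) (ha0 : a ≠ 0)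
    {m : ℕ} (hm : 1 ≤ m) (hPm : P.dim = m + 1) (hd' : 0 < d) (hψ : ψ₀ ≫ ψ₀ = -(d • 𝟙 P))
    {ω : complexBetti P.X (2 + 2 * m)} (hω : IsRationalClass ω) (hω0 : ω ≠ 0)
    (J : (weilDatumOfKsymm hm hPm hd' hψ e ha ha0 hω hω0).Cx →ₗ[ℂ] (weilDatumOfKsymm hm hPm hd' hψ e ha ha0 hω hω0).Cx)
    (hW : Motives.IsWeilComplexStructure (weilDatumOfKsymm hm hPm hd' hψ e ha ha0 hω hω0).hForm J)
    (B : AbelianVariety ℂ) (Φ : B ⟶ B) (β : bettiCohomology P.X 1 ≃ₗ[ℚ] bettiCohomology B.X 1) : Prop :=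
  B.dim = 2 * n ∧ Φ ≫ Φ = -((d : ℤ) • 𝟙 B) ∧
    (∀ x, β (bettiCohomology.map ψ₀.hom.hom.hom 1 x) = bettiCohomology.map Φ.hom.hom.hom 1 (β x)) ∧
    ∀ x ∈ ((weilDatumOfKsymm hm hPm hd' hψ e ha ha0 hω hω0).hodgeStructure J hW.sq).piece 1 0,
      IsOfHodgeType (2 * n) B.X 1 1 0
        (Motives.ofRatClassBaseChange (ComplexPoints B.X) 1 (β.toLinearMap.baseChange ℂ x))

/-- RIEMANN'S EXISTENCE THEOREM AT WEIL TYPE `(n, n)`, discriminant `d` (verbatim the skeleton's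
`Cruxes.ReachHyperbolic.ModuliRiemann.RiemannRealisableAt`, the statement of its transcendental stub `stub_riemannRealisable` and, at
`n = 1`, of the rung `stub_rung_riemannSurfaces`). [cite: DeligneMilne1982Tannakian, art. II §6 Thm. 6.20]
[cite: Deligne1982HodgeCycles, §4 Prop. 4.4 and Lemma 4.6] -/
def RiemannRealisableAt (n d : ℕ) : Prop :=
  ∀ (P : AbelianVariety ℂ) (ψ₀ : P ⟶ P) (e : ProjectiveEmbedding P.X) (a : complexBetti (projectiveSpace e.n ℂ) 2),
    P.dim = 2 * n → ∀ (ha : IsRationalClass a) (ha0 : a ≠ 0), IsWeilType P ψ₀ n d →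
    ∀ {m : ℕ} (hm : 1 ≤ m) (hPm : P.dim = m + 1) (hd' : 0 < d) (hψ : ψ₀ ≫ ψ₀ = -(d • 𝟙 P))
      {ω : complexBetti P.X (2 + 2 * m)} (hω : IsRationalClass ω) (hω0 : ω ≠ 0)
      (J : (weilDatumOfKsymm hm hPm hd' hψ e ha ha0 hω hω0).Cx →ₗ[ℂ] (weilDatumOfKsymm hm hPm hd' hψ e ha ha0 hω hω0).Cx)
      (hW : Motives.IsWeilComplexStructure (weilDatumOfKsymm hm hPm hd' hψ e ha ha0 hω hω0).hForm J),
      ∃ (B : AbelianVariety ℂ) (Φ : B ⟶ B) (β : bettiCohomology P.X 1 ≃ₗ[ℚ] bettiCohomology B.X 1),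
        RealisedBy n d P ψ₀ e ha ha0 hm hPm hd' hψ hω hω0 J hW B Φ β

/-- Unfolding of `RiemannRealisableAt` (its body, for rewriting). [folklore] -/
theorem riemannRealisableAt_iff (n d : ℕ) :
    RiemannRealisableAt n d ↔
      ∀ (P : AbelianVariety ℂ) (ψ₀ : P ⟶ P) (e : ProjectiveEmbedding P.X) (a : complexBetti (projectiveSpace e.n ℂ) 2),
        P.dim = 2 * n → ∀ (ha : IsRationalClass a) (ha0 : a ≠ 0), IsWeilType P ψ₀ n d →
        ∀ {m : ℕ} (hm : 1 ≤ m) (hPm : P.dim = m + 1) (hd' : 0 < d) (hψ : ψ₀ ≫ ψ₀ = -(d • 𝟙 P))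
          {ω : complexBetti P.X (2 + 2 * m)} (hω : IsRationalClass ω) (hω0 : ω ≠ 0)
          (J : (weilDatumOfKsymm hm hPm hd' hψ e ha ha0 hω hω0).Cx →ₗ[ℂ] (weilDatumOfKsymm hm hPm hd' hψ e ha ha0 hω hω0).Cx)
          (hW : Motives.IsWeilComplexStructure (weilDatumOfKsymm hm hPm hd' hψ e ha ha0 hω hω0).hForm J),
          ∃ (B : AbelianVariety ℂ) (Φ : B ⟶ B) (β : bettiCohomology P.X 1 ≃ₗ[ℚ] bettiCohomology B.X 1),
            RealisedBy n d P ψ₀ e ha ha0 hm hPm hd' hψ hω hω0 J hW B Φ β :=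
  Iff.rfl


/-! ## §2 The two period packages of line `moduli-riemann` (appended by leafhand `leafhand-hodge-eightfoldblochseed-3-g0`)

VERBATIM the skeleton's `Cruxes.ReachHyperbolic.ModuliRiemann.PeriodPackage` and `…ModuliCompletePackage` (skeleton
`Cruxes/ReachHyperbolic/Lines/moduli_riemann.lean` 1ba65e5152037605), so that the remaining registered stub
`stub_moduliComplete : ModuliCompletePackage` can be closed BY NAME from `Theorems/`, and so that the glue
`periodPackage_of` / the bridge `hyperbolic_of_periodPackage` can be mirrored in `Theorems/` vocabulary. Bodies unchanged
(copy-paste; `Iff.rfl` with the skeleton's when both are in scope); `RealisedBy` below is §1's. -/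

/-- THE PERIOD-SURJECTIVE PACKAGE — VERBATIM the hypothesis of the venture's bridge
`weilFamilyReach_similar_of_polarizedWeilSystems_of_periodSurjective` (and the skeleton's `PeriodPackage`): through every
Weil-type point `(P, ψ₀, h_K)` a polarized Weil system — a smooth projective family `f : 𝒳 ⟶ S` over an irreducible smooth
quasi-projective base, embedded in `ℙᴺ × S`, with a chart `e' : P ≅ 𝒳_{s₀}`, abelian fibres `(Y s, Ψ s)` with `Ψ² = -d`, flat
sections of Weil classes through every Weil class of `P`, a fibrewise rational `(1,1)` class `H` restricting to `h_K` — which is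
PERIOD-SURJECTIVE: every Weil complex structure `J` on the rational Weil datum of `P` is the `H¹` of some fibre `Y s`, marked by a
`ℚ`-isomorphism `β` intertwining `ψ₀^*` and `(Ψ s)^*`. Route-posited OBJECT of line `moduli-riemann` (not a Literature fact:
the tree has no moduli space of abelian varieties); source of the construction in print: Deligne 1982, §4, proof of Thm. 4.8
(pp. 47–51) and Rem. 4.9; van Geemen 1994, 5.8–5.11. -/
def PeriodPackage : Prop :=
  ∀ (n d : ℕ), 1 ≤ n → 1 ≤ d →
      ∀ (P : AbelianVariety ℂ) (ψ₀ : P ⟶ P) (e : ProjectiveEmbedding P.X)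
        (a : complexBetti (projectiveSpace e.n ℂ) 2),
        P.dim = 2 * n → ∀ (ha : IsRationalClass a) (ha0 : a ≠ 0), IsWeilType P ψ₀ n d →
        ∃ (𝒳 S : SchemeOver ℂ) (f : 𝒳 ⟶ S) (s₀ : ComplexPoints S) (e' : P.X ≅ fiberOver f s₀)
          (Y : ComplexPoints S → AbelianVariety ℂ) (Ψ : ∀ s, Y s ⟶ Y s)
          (ε : ∀ s, (Y s).X ≅ fiberOver f s) (H : complexBetti 𝒳 2),
          IsSmoothProjectiveFamily f (2 * n) ∧
          (∃ (N : ℕ) (ι : 𝒳 ⟶ CategoryTheory.MonoidalCategoryStruct.tensorObj (projectiveSpace N ℂ) S),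
            AlgebraicGeometry.IsClosedImmersion ι.left ∧
              ι ≫ CategoryTheory.CartesianMonoidalCategory.snd (projectiveSpace N ℂ) S = f) ∧
          IrreducibleSpace S.left ∧ AlgebraicGeometry.Smooth S.hom ∧ IsQuasiProjectiveOver S ∧
          (∀ s, (Y s).dim = 2 * n ∧ Ψ s ≫ Ψ s = -((d : ℤ) • 𝟙 (Y s))) ∧
          (∀ w : complexBetti P.X (2 * n), w ∈ weilClassesOf P ψ₀ n d →
            ∃ σ : ComplexPoints S → FiberClass f (2 * n),
              Continuous σ ∧ σ s₀ = ⟨s₀, complexBetti.map e'.inv (2 * n) w⟩ ∧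
              ∀ s, ∃ x : complexBetti (fiberOver f s) (2 * n), σ s = ⟨s, x⟩ ∧
                IsOfHodgeType (2 * n) (fiberOver f s) (2 * n) n n x ∧
                complexBetti.map (ε s).hom (2 * n) x ∈ weilClassesOf (Y s) (Ψ s) n d) ∧
          (∀ s : ComplexPoints S,
            IsRationalClass (complexBetti.map (fiberι f s) 2 H) ∧
              IsOfHodgeType (2 * n) (fiberOver f s) 2 1 1 (complexBetti.map (fiberι f s) 2 H)) ∧
          complexBetti.map e'.hom 2 (complexBetti.map (fiberι f s₀) 2 H) =
            (d : ℂ) • complexBetti.map e.ι 2 a + complexBetti.map ψ₀.hom.hom.hom 2 (complexBetti.map e.ι 2 a) ∧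
          (∃ (m : ℕ) (hm : 1 ≤ m) (hPm : P.dim = m + 1) (hd' : 0 < d) (hψ : ψ₀ ≫ ψ₀ = -(d • 𝟙 P))
              (ω : complexBetti P.X (2 + 2 * m)) (hω : IsRationalClass ω) (hω0 : ω ≠ 0),
            ∀ (J : (weilDatumOfKsymm hm hPm hd' hψ e ha ha0 hω hω0).Cx →ₗ[ℂ]
                (weilDatumOfKsymm hm hPm hd' hψ e ha ha0 hω hω0).Cx)
              (hW : Motives.IsWeilComplexStructure (weilDatumOfKsymm hm hPm hd' hψ e ha ha0 hω hω0).hForm J),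
              ∃ (s : ComplexPoints S) (β : bettiCohomology P.X 1 ≃ₗ[ℚ] bettiCohomology (Y s).X 1),
                (∀ x, β (bettiCohomology.map ψ₀.hom.hom.hom 1 x) =
                  bettiCohomology.map (Ψ s).hom.hom.hom 1 (β x)) ∧
                ∀ x ∈ ((weilDatumOfKsymm hm hPm hd' hψ e ha ha0 hω hω0).hodgeStructure J hW.sq).piece 1 0,
                  IsOfHodgeType (2 * n) (Y s).X 1 1 0
                    (Motives.ofRatClassBaseChange (ComplexPoints (Y s).X) 1 (β.toLinearMap.baseChange ℂ x)))

/-- THE ALGEBRAIC HALF — the statement of the registered Riemann-free stub `stub_moduliComplete` of line `moduli-riemann`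
(verbatim the skeleton's `ModuliCompletePackage`): the same package, but period-surjective only for REALISABLE periods — a
universal family COMPLETE for abelian varieties with `√-d`-multiplication marked on `H¹(P)` (`RealisedBy`, §1). Route-posited
OBJECT (the registered stub's statement, not a Literature fact); sources in print: Mumford–Fogarty–Kirwan 1994, Thm. 7.9–7.10;
Deligne 1982, proof of Thm. 4.8 (pp. 48–51) and Rem. 4.9. -/
def ModuliCompletePackage : Prop :=
  ∀ (n d : ℕ), 1 ≤ n → 1 ≤ d →
      ∀ (P : AbelianVariety ℂ) (ψ₀ : P ⟶ P) (e : ProjectiveEmbedding P.X)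
        (a : complexBetti (projectiveSpace e.n ℂ) 2),
        P.dim = 2 * n → ∀ (ha : IsRationalClass a) (ha0 : a ≠ 0), IsWeilType P ψ₀ n d →
        ∃ (𝒳 S : SchemeOver ℂ) (f : 𝒳 ⟶ S) (s₀ : ComplexPoints S) (e' : P.X ≅ fiberOver f s₀)
          (Y : ComplexPoints S → AbelianVariety ℂ) (Ψ : ∀ s, Y s ⟶ Y s)
          (ε : ∀ s, (Y s).X ≅ fiberOver f s) (H : complexBetti 𝒳 2),
          IsSmoothProjectiveFamily f (2 * n) ∧
          (∃ (N : ℕ) (ι : 𝒳 ⟶ CategoryTheory.MonoidalCategoryStruct.tensorObj (projectiveSpace N ℂ) S),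
            AlgebraicGeometry.IsClosedImmersion ι.left ∧
              ι ≫ CategoryTheory.CartesianMonoidalCategory.snd (projectiveSpace N ℂ) S = f) ∧
          IrreducibleSpace S.left ∧ AlgebraicGeometry.Smooth S.hom ∧ IsQuasiProjectiveOver S ∧
          (∀ s, (Y s).dim = 2 * n ∧ Ψ s ≫ Ψ s = -((d : ℤ) • 𝟙 (Y s))) ∧
          (∀ w : complexBetti P.X (2 * n), w ∈ weilClassesOf P ψ₀ n d →
            ∃ σ : ComplexPoints S → FiberClass f (2 * n),
              Continuous σ ∧ σ s₀ = ⟨s₀, complexBetti.map e'.inv (2 * n) w⟩ ∧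
              ∀ s, ∃ x : complexBetti (fiberOver f s) (2 * n), σ s = ⟨s, x⟩ ∧
                IsOfHodgeType (2 * n) (fiberOver f s) (2 * n) n n x ∧
                complexBetti.map (ε s).hom (2 * n) x ∈ weilClassesOf (Y s) (Ψ s) n d) ∧
          (∀ s : ComplexPoints S,
            IsRationalClass (complexBetti.map (fiberι f s) 2 H) ∧
              IsOfHodgeType (2 * n) (fiberOver f s) 2 1 1 (complexBetti.map (fiberι f s) 2 H)) ∧
          complexBetti.map e'.hom 2 (complexBetti.map (fiberι f s₀) 2 H) =
            (d : ℂ) • complexBetti.map e.ι 2 a + complexBetti.map ψ₀.hom.hom.hom 2 (complexBetti.map e.ι 2 a) ∧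
          (∃ (m : ℕ) (hm : 1 ≤ m) (hPm : P.dim = m + 1) (hd' : 0 < d) (hψ : ψ₀ ≫ ψ₀ = -(d • 𝟙 P))
              (ω : complexBetti P.X (2 + 2 * m)) (hω : IsRationalClass ω) (hω0 : ω ≠ 0),
            ∀ (J : (weilDatumOfKsymm hm hPm hd' hψ e ha ha0 hω hω0).Cx →ₗ[ℂ]
                (weilDatumOfKsymm hm hPm hd' hψ e ha ha0 hω hω0).Cx)
              (hW : Motives.IsWeilComplexStructure (weilDatumOfKsymm hm hPm hd' hψ e ha ha0 hω hω0).hForm J),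
              (∃ (B : AbelianVariety ℂ) (Φ : B ⟶ B) (β : bettiCohomology P.X 1 ≃ₗ[ℚ] bettiCohomology B.X 1),
                  RealisedBy n d P ψ₀ e ha ha0 hm hPm hd' hψ hω hω0 J hW B Φ β) →
              ∃ (s : ComplexPoints S) (β : bettiCohomology P.X 1 ≃ₗ[ℚ] bettiCohomology (Y s).X 1),
                (∀ x, β (bettiCohomology.map ψ₀.hom.hom.hom 1 x) =
                  bettiCohomology.map (Ψ s).hom.hom.hom 1 (β x)) ∧
                ∀ x ∈ ((weilDatumOfKsymm hm hPm hd' hψ e ha ha0 hω hω0).hodgeStructure J hW.sq).piece 1 0,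
                  IsOfHodgeType (2 * n) (Y s).X 1 1 0
                    (Motives.ofRatClassBaseChange (ComplexPoints (Y s).X) 1 (β.toLinearMap.baseChange ℂ x)))

/-! ## §3 The PAD-4 CM anchor vocabulary — VERBATIM §0–§1 of the registered skeletons `Cruxes/BlochSeedsGeneric/Lines/pad4_cm_anchor.lean`
(fb115e60acaf2337, crux `BlochSeedsGeneric`, item stmt-HodgeConjecture-18880) and `Cruxes/BlochSeedDiscThree/Lines/pad4_cm_anchor.lean`
(d208bf462bd6e07f, crux `BlochSeedDiscThree`, item 18882; identical §0–§1, only the namespace differs), in whose vocabulary the registered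
stubs `stub_rung_pad4_seedAt` / `stub_pad4_carrier` are stated (`pad4Anchor`, `pad4Action`, `symH`, `HasLciCarrierAt`). Appended by
leafhand `leafhand-hodge-eightfoldblochseed-3-g1` so that the stubs become statable — and, once the one remaining named fact
`Literature.AlgebraicGeometry.HodgeTheory.kleiman1969_smoothingCycles_eightfold_codimFour` is a theorem, closable — BY NAME from
`Theorems/` (the conditional closer `Theorems/EightfoldBlochSeedsBlochSeedsGenericPad4CarrierStubOfKleimanSmoothing` has literally the
stub's type). Bodies unchanged (copy-paste; the skeleton's abbreviations reduce to these by `rfl` when both are in scope). -/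

section Pad4Anchor

variable (E₀ : AbelianVariety ℂ) (ψ₀ : E₀ ⟶ E₀)

/-- The Weil surface `S = E₀ × E₀` (verbatim the skeletons' `weilSurf`). [cite: vanGeemen1994HodgeAV, 5.3–5.5] -/
abbrev weilSurf : AbelianVariety ℂ := E₀.prod E₀

/-- Its Weil action `φ_S = ψ₀ × (-ψ₀)` (verbatim the skeletons' `weilSurfAct`). [cite: vanGeemen1994HodgeAV, 5.3–5.5] -/
abbrev weilSurfAct : weilSurf E₀ ⟶ weilSurf E₀ :=
  AbelianVariety.prodLift (AbelianVariety.fst E₀ E₀ ≫ ψ₀) (AbelianVariety.snd E₀ E₀ ≫ (-ψ₀))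

/-- `S² = S × S` (verbatim). [cite: vanGeemen1994HodgeAV, 5.3–5.5] -/
abbrev pad2Anchor : AbelianVariety ℂ := (weilSurf E₀).prod (weilSurf E₀)
/-- `S³ = S² × S` (verbatim). [cite: vanGeemen1994HodgeAV, 5.3–5.5] -/
abbrev pad3Anchor : AbelianVariety ℂ := (pad2Anchor E₀).prod (weilSurf E₀)
/-- The PAD-4 anchor `S⁴ = S³ × S` (verbatim the skeletons' `pad4Anchor`). [cite: vanGeemen1994HodgeAV, 5.3–5.5] -/
abbrev pad4Anchor : AbelianVariety ℂ := (pad3Anchor E₀).prod (weilSurf E₀)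

/-- Product action on `S²` (verbatim). [cite: vanGeemen1994HodgeAV, 5.3–5.5] -/
abbrev pad2Action : pad2Anchor E₀ ⟶ pad2Anchor E₀ :=
  AbelianVariety.prodLift (AbelianVariety.fst _ _ ≫ weilSurfAct E₀ ψ₀) (AbelianVariety.snd _ _ ≫ weilSurfAct E₀ ψ₀)
/-- Product action on `S³` (verbatim). [cite: vanGeemen1994HodgeAV, 5.3–5.5] -/
abbrev pad3Action : pad3Anchor E₀ ⟶ pad3Anchor E₀ :=
  AbelianVariety.prodLift (AbelianVariety.fst _ _ ≫ pad2Action E₀ ψ₀) (AbelianVariety.snd _ _ ≫ weilSurfAct E₀ ψ₀)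
/-- The PAD-4 action `Ψ = (ψ₀ × (−ψ₀))⁴` on `S⁴` (verbatim the skeletons' `pad4Action`). [cite: vanGeemen1994HodgeAV, 5.3–5.5] -/
abbrev pad4Action : pad4Anchor E₀ ⟶ pad4Anchor E₀ :=
  AbelianVariety.prodLift (AbelianVariety.fst _ _ ≫ pad3Action E₀ ψ₀) (AbelianVariety.snd _ _ ≫ weilSurfAct E₀ ψ₀)

/-- The `K`-symmetrised hyperplane class `h_K(e, a) = d·ι^*a + ψ^*ι^*a` (the literal shape inside `HasHyperbolicBlochSeed 4 d`;
verbatim the skeletons' `symH`). [cite: vanGeemen1994HodgeAV, Lemma 5.2 (1)] -/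
abbrev symH (d : ℕ) {P : AbelianVariety ℂ} (ψ : P ⟶ P) (e : ProjectiveEmbedding P.X)
    (a : complexBetti (projectiveSpace e.n ℂ) 2) : complexBetti P.X 2 :=
  (d : ℂ) • complexBetti.map e.ι 2 a + complexBetti.map ψ.hom.hom.hom 2 (complexBetti.map e.ι 2 a)

end Pad4Anchor

/-- An integral lci CARRIER of `q·hⁿ + w` on `P` = `HasBlochSeedAt n P h w` with the Bloch-semiregularity clause deleted (all other
conjuncts verbatim) — verbatim the skeletons' sub-rung vocabulary `HasLciCarrierAt` (§1 of both `pad4_cm_anchor.lean`).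
[cite: Bloch1972Semiregularity, Remark (7.5)] [cite: Fulton1998, Ex. 14.1.1 and §14.4] -/
def HasLciCarrierAt (n : ℕ) (P : AbelianVariety ℂ) (h : complexBetti P.X 2) (w : complexBetti P.X (2 * n)) : Prop :=
  ∃ (Z : Scheme.{0}) (i : Z ⟶ P.X.left) (q : ℚ),
    IsClosedImmersion i ∧ IsRegularImmersionOfCodim i n ∧ AlgebraicGeometry.IsIntegral Z ∧
    (∀ z ∈ Set.range i.base, (n : ℕ∞) ≤ Order.coheight z) ∧
    ((q : ℚ) : ℂ) • cupPowTwo h n + w ∈ classesSupportedOn P.X (Set.range i.base) (2 * n)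

/-- A Bloch seed is in particular an lci carrier (verbatim the skeletons' `hasLciCarrierAt_of_hasBlochSeedAt`).
[cite: Bloch1972Semiregularity, Remark (7.5)] -/
theorem hasLciCarrierAt_of_hasBlochSeedAt {n : ℕ} {P : AbelianVariety ℂ} {h : complexBetti P.X 2}
    {w : complexBetti P.X (2 * n)} (hS : HasBlochSeedAt n P h w) : HasLciCarrierAt n P h w := by
  obtain ⟨Z, i, q, hi, hreg, hint, hcoh, -, hsupp⟩ := hS
  exact ⟨Z, i, q, hi, hreg, hint, hcoh, hsupp⟩

end Summit.HodgeConjecture.HodgeConjecture.Theorems.EightfoldBlochSeeds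

end
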